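import Mathlib
import Summits.KontsevichZagierPeriods.KontsevichZagierPeriods.Theorems.SoloInformedScaleBand
import Summits.KontsevichZagierPeriods.KontsevichZagierPeriods.Theorems.SoloInformedTelescopeStep
import Summits.KontsevichZagierPeriods.KontsevichZagierPeriods.Theorems.SoloInformedRatJacobian
import HarnessLib
import HarnessLib.Audit

/-!
# SoloInformed — the SCALE BAND step (PART XVI, PROGRAMME L): datum and fibre calculus

Solo programme `solo-KontsevichZagierPeriods-informed`, session s48 (PROGRAMME L, file 2).

THE STEP.  Dimension `n`, one ACTIVE coordinate `i`, a rational function `Φ = P/Q`, and passive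
polynomials `ω = Ω`, `c = 1/C` (free of `Xᵢ`), over a `ℚ`-semialgebraic cylinder `D` (invariant
under moving `xᵢ` inside `(0,1)`) on which `0 < ω < 1`, `C > 0`:

  `A = [D ∩ {ω < xᵢ},  Φ/(C(1 − ω))]`,   `B = [D,  (Φ(x) − ω·Φ(x|xᵢ ↦ ω xᵢ))/(C(1 − ω))]`.

THEOREM (`SoloInformedScaleStep`): `[A] − [B] ∈ KZ.relations`, by two Newton–Leibniz moves
(rule (3)) along an auxiliary last coordinate `λ` with the SAME primitive

  `F(y, λ) = λ·Φ(y|yᵢ ↦ λ yᵢ)/(C(1 − ω))`,  `g = ∂F/∂λ`,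

read over two bands: `M = [{(z,λ) | z ∈ D ∩ {ω < zᵢ}, 0 ≤ λ ≤ 1}, g]` (fibre integral `= A`) and
`N = [{(y,λ) | y ∈ D, ω(y) ≤ λ ≤ 1}, g]` (fibre integral `= B`), which the coordinate swap
`zᵢ ↔ λ` identifies up to null sets (rules (2), (1)): Euler's homogeneity `u∂ᵤ = λ∂_λ` on `f(λu)`.
This is the series-free form of the ⋆-regularisation `Σ_{n} aₙ(1 − bⁿ)/(1 − b)`: with `Φ` the cube
integrand of `ζ(k)` and `ω = b` a fresh variable it realises Kaneko–Yamamoto's integral–series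
identity for the index `(1)` (Hoffman's relations) inside the KZ calculus (files `SoloInformedHoffman*`).

This file: the datum `SoloInformedScaleDatum`, the functions `Φ, Φᵢ', f_A, f_B, F, g`, the domains,
the swap, and the fibre calculus (`hasDerivAt_F`: `∂_λ F = g`; `g ≥ 0` from the monotonicity of
`t ↦ tΦ(x|xᵢ ↦ t)`).

References: Kontsevich–Zagier 2001 §1.2 [KontsevichZagier2001]; M. Kaneko, S. Yamamoto,
arXiv:1605.03117, Thm 4.1, Rem. 7.3; M. Hoffman, Multiple harmonic series, Pacific J. Math. 152
(1992) Thm 5.1.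
-/

noncomputable section

open MeasureTheory Set MvPolynomial
open Literature.ModelTheory.ExponentialFields Literature.NumberTheory.Transcendental
open Literature.NumberTheory.Transcendental.KZ

namespace Summit.KontsevichZagierPeriods.KontsevichZagierPeriods.Theorems

/-! ## 0. Scaling one slot of a substitution -/

/-- Evaluating `p` after the substitution `v` with its `i`-th entry scaled by `c` is evaluating `p`
at the point `(v(w))|ᵢ ↦ c(w)·vᵢ(w)`. [folklore] -/
theorem soloInformed_aeval_bind₁_update {σ : Type*} {n : ℕ} (v : Fin n → MvPolynomial σ ℚ)
    (i : Fin n) (c : MvPolynomial σ ℚ) (p : MvPolynomial (Fin n) ℚ) (w : σ → ℝ) :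
    (aeval w (bind₁ (Function.update v i (c * v i)) p) : ℝ) =
      aeval (Function.update (fun j => (aeval w (v j) : ℝ)) i (aeval w c * aeval w (v i))) p := by
  have h : (fun j => (aeval w (Function.update v i (c * v i) j) : ℝ)) =
      Function.update (fun j => (aeval w (v j) : ℝ)) i (aeval w c * aeval w (v i)) := by
    funext j
    by_cases hj : j = i
    · subst hj; simp
    · simp [Function.update_of_ne hj]
  rw [aeval_bind₁, h]

/-! ## 1. The datum -/

/-- `f_B = (Φ(x) − ω Φ(x|xᵢ ↦ ω xᵢ))/(C(1 − ω))`, the `B`-integrand, as a function of the raw data. -/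
def soloInformedScaleFB {n : ℕ} (i : Fin n) (P Q Ω C : MvPolynomial (Fin n) ℚ)
    (x : Fin n → ℝ) : ℝ :=
  ((aeval x P : ℝ) / aeval x Q - aeval x Ω *
      ((aeval (Function.update x i (aeval x Ω * x i)) P : ℝ) /
        aeval (Function.update x i (aeval x Ω * x i)) Q)) /
    (aeval x C * (1 - aeval x Ω))

/-- **The datum of a scale-band step**: active coordinate `i`, `Φ = P/Q`, passive `Ω, C` free of
`Xᵢ`, a semialgebraic cylinder `D` over `xᵢ ∈ (0,1)` with `0 < ω < 1`, `C > 0`, `Q ≠ 0` along the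
closed active fibres, `t ↦ tΦ(x|xᵢ ↦ t)` monotone on `[0,1]`, and integrability of the `B`-side. -/
structure SoloInformedScaleDatum (n : ℕ) where
  /-- the active coordinate -/
  i : Fin n
  /-- numerator of `Φ` -/
  P : MvPolynomial (Fin n) ℚ
  /-- denominator of `Φ` -/
  Q : MvPolynomial (Fin n) ℚ
  /-- the passive polynomial `ω` -/
  Ω : MvPolynomial (Fin n) ℚ
  /-- the passive polynomial `C`; the integrands carry `1/C` -/
  C : MvPolynomial (Fin n) ℚ
  /-- the cylinder -/
  D : Set (Fin n → ℝ)
  /-- `D` is `ℚ`-semialgebraic -/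
  isSemialgebraic_D : IsSemialgebraic ℚ D
  /-- `D` is invariant under moving the active coordinate inside `(0,1)` -/
  update_mem : ∀ x ∈ D, ∀ t : ℝ, 0 < t → t < 1 → Function.update x i t ∈ D
  /-- on `D` the active coordinate lies in `(0,1)` -/
  mem_Ioo : ∀ x ∈ D, 0 < x i ∧ x i < 1
  /-- `Ω` does not involve `Xᵢ` -/
  vars_Ω : i ∉ Ω.vars
  /-- `C` does not involve `Xᵢ` -/
  vars_C : i ∉ C.vars
  /-- `0 < ω < 1` on `D` -/
  Ω_bound : ∀ x ∈ D, 0 < (aeval x Ω : ℝ) ∧ (aeval x Ω : ℝ) < 1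
  /-- `C > 0` on `D` -/
  C_pos : ∀ x ∈ D, 0 < (aeval x C : ℝ)
  /-- `Q ≠ 0` on the closed active fibres -/
  Q_ne : ∀ x ∈ D, ∀ t ∈ Icc (0 : ℝ) 1, (aeval (Function.update x i t) Q : ℝ) ≠ 0
  /-- `t ↦ t·Φ(x|xᵢ ↦ t)` is monotone on `[0,1]` -/
  mono : ∀ x ∈ D, MonotoneOn (fun t : ℝ =>
    t * ((aeval (Function.update x i t) P : ℝ) / aeval (Function.update x i t) Q)) (Icc 0 1)
  /-- the `B`-integrand is integrable on `D` -/
  integrableOn_fB : IntegrableOn (soloInformedScaleFB i P Q Ω C) D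

namespace SoloInformedScaleDatum

variable {n : ℕ} (T : SoloInformedScaleDatum n)

/-! ## 2. The functions -/

/-- `Φ = P/Q`. -/
def φ (x : Fin n → ℝ) : ℝ := (aeval x T.P : ℝ) / aeval x T.Q
/-- `∂Φ/∂xᵢ = (Q ∂ᵢP − P ∂ᵢQ)/Q²`. -/
def φ' (x : Fin n → ℝ) : ℝ :=
  ((aeval x T.Q : ℝ) * aeval x (pderiv T.i T.P) - aeval x T.P * aeval x (pderiv T.i T.Q)) /
    aeval x T.Q ^ 2
/-- `ω(x)`. -/
def ω (x : Fin n → ℝ) : ℝ := aeval x T.Ω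
/-- `C(x)`. -/
def cc (x : Fin n → ℝ) : ℝ := aeval x T.C
/-- `f_A = Φ/(C(1 − ω))`. -/
def fA (x : Fin n → ℝ) : ℝ := T.φ x / (T.cc x * (1 - T.ω x))
/-- `f_B = (Φ(x) − ωΦ(x|xᵢ ↦ ωxᵢ))/(C(1 − ω))`. -/
def fB : (Fin n → ℝ) → ℝ := soloInformedScaleFB T.i T.P T.Q T.Ω T.C
/-- The scaled point `y|yᵢ ↦ λ yᵢ` of `w = (y, λ)`. -/
def pt (w : Fin (n + 1) → ℝ) : Fin n → ℝ :=
  Function.update (Fin.init w) T.i (w (Fin.last n) * Fin.init w T.i)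
/-- The primitive `F(y, λ) = λ Φ(y|yᵢ ↦ λyᵢ)/(C(y)(1 − ω(y)))`. -/
def F (w : Fin (n + 1) → ℝ) : ℝ :=
  w (Fin.last n) * T.φ (T.pt w) / (T.cc (Fin.init w) * (1 - T.ω (Fin.init w)))
/-- The band integrand `g = ∂F/∂λ = (Φ + λyᵢ ∂ᵢΦ)(y|yᵢ ↦ λyᵢ)/(C(1 − ω))`. -/
def g (w : Fin (n + 1) → ℝ) : ℝ :=
  (T.φ (T.pt w) + w (Fin.last n) * Fin.init w T.i * T.φ' (T.pt w)) /
    (T.cc (Fin.init w) * (1 - T.ω (Fin.init w)))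

/-- `f_B` unfolded. -/
theorem fB_eq (x : Fin n → ℝ) : T.fB x =
    (T.φ x - T.ω x * T.φ (Function.update x T.i (T.ω x * x T.i))) / (T.cc x * (1 - T.ω x)) := rfl

/-! ## 3. The domains and the swap -/

/-- `D_A = D ∩ {ω < xᵢ}`. -/
def DA : Set (Fin n → ℝ) := T.D ∩ {x | T.ω x < x T.i}
/-- The band of `M`: `{(z, λ) | z ∈ D_A, 0 ≤ λ ≤ 1}`. -/
def bandM : Set (Fin (n + 1) → ℝ) :=
  {w | (Fin.init w : Fin n → ℝ) ∈ T.DA ∧ (fun _ : Fin n → ℝ => (0 : ℝ)) (Fin.init w) ≤ w (Fin.last n) ∧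
    w (Fin.last n) ≤ (fun _ : Fin n → ℝ => (1 : ℝ)) (Fin.init w)}
/-- The band of `N`: `{(y, λ) | y ∈ D, ω(y) ≤ λ ≤ 1}`. -/
def bandN : Set (Fin (n + 1) → ℝ) :=
  {w | (Fin.init w : Fin n → ℝ) ∈ T.D ∧ T.ω (Fin.init w) ≤ w (Fin.last n) ∧
    w (Fin.last n) ≤ (fun _ : Fin n → ℝ => (1 : ℝ)) (Fin.init w)}
/-- The swap of the active coordinate with the auxiliary one. -/
def e : Fin (n + 1) ≃ Fin (n + 1) := Equiv.swap (Fin.castSucc T.i) (Fin.last n)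

/-- Membership in `bandM`. -/
theorem mem_bandM (w : Fin (n + 1) → ℝ) :
    w ∈ T.bandM ↔ Fin.init w ∈ T.DA ∧ 0 ≤ w (Fin.last n) ∧ w (Fin.last n) ≤ 1 := Iff.rfl
/-- Membership in `bandN`. -/
theorem mem_bandN (w : Fin (n + 1) → ℝ) :
    w ∈ T.bandN ↔ Fin.init w ∈ T.D ∧ T.ω (Fin.init w) ≤ w (Fin.last n) ∧ w (Fin.last n) ≤ 1 :=
  Iff.rfl

section pointwise

variable {T} {x : Fin n → ℝ} (hx : x ∈ T.D)
include hx

/-- Auxiliary (scale step): `ω_pos`. -/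
theorem ω_pos : 0 < T.ω x := (T.Ω_bound x hx).1
/-- Auxiliary (scale step): `ω_lt_one`. -/
theorem ω_lt_one : T.ω x < 1 := (T.Ω_bound x hx).2
/-- Auxiliary (scale step): the constant `C(1 − ω) > 0`. -/
theorem K_pos : 0 < T.cc x * (1 - T.ω x) := mul_pos (T.C_pos x hx) (sub_pos.2 (ω_lt_one hx))
/-- Auxiliary (scale step): `Q(x|xᵢ ↦ t) ≠ 0` for `t ∈ [0,1]`. -/
theorem q_ne {t : ℝ} (ht0 : 0 ≤ t) (ht1 : t ≤ 1) :
    (aeval (Function.update x T.i t) T.Q : ℝ) ≠ 0 := T.Q_ne x hx t ⟨ht0, ht1⟩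
/-- Auxiliary (scale step): `Q(x) ≠ 0`. -/
theorem q_ne_self : (aeval x T.Q : ℝ) ≠ 0 := by
  have h := q_ne hx (T.mem_Ioo x hx).1.le (T.mem_Ioo x hx).2.le
  rwa [Function.update_eq_self] at h

end pointwise

/-! ### invariance under the active coordinate -/

/-- Auxiliary (scale step): `ω_update`. -/
theorem ω_update (x : Fin n → ℝ) (t : ℝ) : T.ω (Function.update x T.i t) = T.ω x :=
  soloInformed_aeval_update T.vars_Ω x t
/-- Auxiliary (scale step): `C` ignores the active coordinate (as a function identity). -/
theorem cc_comp_update (t : ℝ) : (fun x => T.cc (Function.update x T.i t)) = T.cc :=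
  funext fun x => soloInformed_aeval_update T.vars_C x t

/-! ### the swap -/

/-- Auxiliary (scale step): `e` sends the active slot to the last one. -/
theorem e_castSucc_i : T.e (Fin.castSucc T.i) = Fin.last n := Equiv.swap_apply_left _ _
/-- Auxiliary (scale step): `e` sends the last slot to the active one. -/
theorem e_last : T.e (Fin.last n) = Fin.castSucc T.i := Equiv.swap_apply_right _ _
/-- Auxiliary (scale step): `e` fixes the other slots. -/
theorem e_castSucc_of_ne {j : Fin n} (hj : j ≠ T.i) : T.e (Fin.castSucc j) = Fin.castSucc j :=
  Equiv.swap_apply_of_ne_of_ne (fun h => hj (Fin.castSucc_injective _ h))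
    (Fin.castSucc_lt_last j).ne

/-- **The swap on points**: `init (w ∘ e) = (init w)|ᵢ ↦ w_last`. -/
theorem init_comp_e (w : Fin (n + 1) → ℝ) :
    Fin.init (fun j => w (T.e j)) = Function.update (Fin.init w) T.i (w (Fin.last n)) := by
  ext j
  simp only [Fin.init]
  by_cases hj : j = T.i
  · subst hj
    rw [Function.update_self, e_castSucc_i]
  · rw [Function.update_of_ne hj, e_castSucc_of_ne T hj]
    rfl

/-- **The swap on points**: `(w ∘ e)_last = (init w)ᵢ`. -/
theorem comp_e_last (w : Fin (n + 1) → ℝ) : (fun j => w (T.e j)) (Fin.last n) = Fin.init w T.i := by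
  simp only [e_last]
  rfl

/-- The scaled point is swap-invariant. -/
theorem pt_comp_e (w : Fin (n + 1) → ℝ) : T.pt (fun j => w (T.e j)) = T.pt w := by
  simp only [pt, init_comp_e, comp_e_last, Function.update_self, Function.update_idem]
  rw [mul_comm]

/-- **The band integrand is swap-invariant.** -/
theorem g_comp_e (w : Fin (n + 1) → ℝ) : T.g (fun j => w (T.e j)) = T.g w := by
  simp only [g, pt_comp_e, init_comp_e, comp_e_last, Function.update_self, ω_update,
    congrFun (T.cc_comp_update _)]
  rw [mul_comm (Fin.init w T.i)]

/-! ### the fibres of `F` -/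

/-- Auxiliary (scale step): the scaled point of `(y, s)`. -/
theorem pt_snoc (y : Fin n → ℝ) (s : ℝ) :
    T.pt (Fin.snoc y s) = Function.update y T.i (s * y T.i) := by
  simp [pt, Fin.init_snoc, Fin.snoc_last]

/-- Auxiliary (scale step): `F` on a fibre. -/
theorem F_snoc (y : Fin n → ℝ) (s : ℝ) :
    T.F (Fin.snoc y s) = s * T.φ (Function.update y T.i (s * y T.i)) / (T.cc y * (1 - T.ω y)) := by
  simp [F, pt_snoc, Fin.init_snoc, Fin.snoc_last]

/-- Auxiliary (scale step): `g` on a fibre. -/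
theorem g_snoc (y : Fin n → ℝ) (s : ℝ) :
    T.g (Fin.snoc y s) = (T.φ (Function.update y T.i (s * y T.i)) +
      s * y T.i * T.φ' (Function.update y T.i (s * y T.i))) / (T.cc y * (1 - T.ω y)) := by
  simp [g, pt_snoc, Fin.init_snoc, Fin.snoc_last]

/-- `F(y, 1) − F(y, ω(y)) = f_B(y)`: the fibre integral of `N` is the `B`-integrand. -/
theorem F_one_sub_F_ω {y : Fin n → ℝ} (hy : y ∈ T.D) :
    T.fB y = T.F (Fin.snoc y 1) - T.F (Fin.snoc y (T.ω y)) := by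
  rw [F_snoc, F_snoc, fB_eq, one_mul, one_mul, Function.update_eq_self]
  have hK := K_pos hy
  field_simp

/-- `F(z, 1) − F(z, 0) = f_A(z)`: the fibre integral of `M` is the `A`-integrand. -/
theorem F_one_sub_F_zero (z : Fin n → ℝ) :
    T.fA z = T.F (Fin.snoc z 1) - T.F (Fin.snoc z 0) := by
  rw [F_snoc, F_snoc, fA, one_mul, one_mul, Function.update_eq_self]
  simp

/-! ## 4. The fibre calculus: `∂F/∂λ = g`, `g ≥ 0` -/

/-- **`∂F/∂λ = g` along the fibres**, for `λ ∈ [0,1]` over `y ∈ D` (chain rule through the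
quotient rule `soloInformed_hasFDerivAt_aeval_div` and `hasDerivAt_update`). -/
theorem hasDerivAt_F {y : Fin n → ℝ} (hy : y ∈ T.D) {t : ℝ} (ht : t ∈ Icc (0 : ℝ) 1) :
    HasDerivAt (fun s : ℝ => T.F (Fin.snoc y s)) (T.g (Fin.snoc y t)) t := by
  have hyi := T.mem_Ioo y hy
  have hQ : (aeval (Function.update y T.i (t * y T.i)) T.Q : ℝ) ≠ 0 :=
    q_ne hy (mul_nonneg ht.1 hyi.1.le) (mul_le_one₀ ht.2 hyi.1.le hyi.2.le)
  -- the inner map `s ↦ y|ᵢ ↦ s yᵢ`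
  have h1 : HasDerivAt (fun s : ℝ => Function.update y T.i (s * y T.i))
      ((y T.i) • Pi.single T.i (1 : ℝ)) t := by
    have ha : HasDerivAt (fun s : ℝ => s * y T.i) (y T.i) t := by
      simpa using (hasDerivAt_id t).mul_const (y T.i)
    exact (hasDerivAt_update y T.i (t * y T.i)).scomp t ha
  -- the quotient rule at the scaled point
  have h2 := (soloInformed_hasFDerivAt_aeval_div T.P T.Q _ hQ).comp_hasDerivAt t h1
  have hval : (∑ j : Fin n, (((aeval (Function.update y T.i (t * y T.i)) T.Q : ℝ) *
        aeval (Function.update y T.i (t * y T.i)) (pderiv j T.P) -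
        aeval (Function.update y T.i (t * y T.i)) T.P *
        aeval (Function.update y T.i (t * y T.i)) (pderiv j T.Q)) /
        aeval (Function.update y T.i (t * y T.i)) T.Q ^ 2) •
        ContinuousLinearMap.proj (R := ℝ) (φ := fun _ : Fin n => ℝ) j)
        ((y T.i) • Pi.single T.i (1 : ℝ)) =
      T.φ' (Function.update y T.i (t * y T.i)) * y T.i := by
    simp [Pi.single_apply, Finset.sum_ite_eq', φ']
    ring
  have h2' : HasDerivAt (fun s : ℝ => T.φ (Function.update y T.i (s * y T.i)))
      (T.φ' (Function.update y T.i (t * y T.i)) * y T.i) t := by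
    rw [← hval]
    exact h2
  have h3 : HasDerivAt
      (fun s : ℝ => s * T.φ (Function.update y T.i (s * y T.i)) / (T.cc y * (1 - T.ω y)))
      ((1 * T.φ (Function.update y T.i (t * y T.i)) +
        t * (T.φ' (Function.update y T.i (t * y T.i)) * y T.i)) / (T.cc y * (1 - T.ω y))) t :=
    ((hasDerivAt_id' t).mul h2').div_const (T.cc y * (1 - T.ω y))
  have hfun : (fun s : ℝ => T.F (Fin.snoc y s)) =
      fun s => s * T.φ (Function.update y T.i (s * y T.i)) / (T.cc y * (1 - T.ω y)) := by
    funext s; rw [F_snoc]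
  rw [hfun]
  refine h3.congr_deriv ?_
  rw [g_snoc]
  ring

/-- `F` is continuous on the closed fibres `[0,1]` over `D`. -/
theorem continuousOn_F {y : Fin n → ℝ} (hy : y ∈ T.D) {a b : ℝ} (ha : 0 ≤ a) (hb : b ≤ 1) :
    ContinuousOn (fun s : ℝ => T.F (Fin.snoc y s)) (Icc a b) := fun _ hs =>
  (T.hasDerivAt_F hy ⟨ha.trans hs.1, hs.2.trans hb⟩).continuousAt.continuousWithinAt

/-- `λ ↦ F(y, λ)` is monotone on `[0,1]` (from the monotonicity field of the datum). -/
theorem monotoneOn_F {y : Fin n → ℝ} (hy : y ∈ T.D) :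
    MonotoneOn (fun s : ℝ => T.F (Fin.snoc y s)) (Icc 0 1) := by
  intro s hs s' hs' hss'
  have hyi := T.mem_Ioo y hy
  have hK := K_pos hy
  simp only [F_snoc]
  rw [div_le_div_iff_of_pos_right hK]
  have hm := T.mono y hy ⟨mul_nonneg hs.1 hyi.1.le, mul_le_one₀ hs.2 hyi.1.le hyi.2.le⟩
    ⟨mul_nonneg hs'.1 hyi.1.le, mul_le_one₀ hs'.2 hyi.1.le hyi.2.le⟩
    (mul_le_mul_of_nonneg_right hss' hyi.1.le)
  simp only [φ] at hm ⊢
  refine le_of_mul_le_mul_right ?_ hyi.1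
  calc s * ((aeval (Function.update y T.i (s * y T.i)) T.P : ℝ) /
        aeval (Function.update y T.i (s * y T.i)) T.Q) * y T.i
      = s * y T.i * ((aeval (Function.update y T.i (s * y T.i)) T.P : ℝ) /
        aeval (Function.update y T.i (s * y T.i)) T.Q) := by ring
    _ ≤ s' * y T.i * ((aeval (Function.update y T.i (s' * y T.i)) T.P : ℝ) /
        aeval (Function.update y T.i (s' * y T.i)) T.Q) := hm
    _ = s' * ((aeval (Function.update y T.i (s' * y T.i)) T.P : ℝ) /
        aeval (Function.update y T.i (s' * y T.i)) T.Q) * y T.i := by ring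

/-- **`g ≥ 0` on the open fibres** `(0,1)` over `D`. -/
theorem g_nonneg {y : Fin n → ℝ} (hy : y ∈ T.D) {t : ℝ} (ht : t ∈ Ioo (0 : ℝ) 1) :
    0 ≤ T.g (Fin.snoc y t) :=
  soloInformed_deriv_nonneg_of_monotoneOn (T.monotoneOn_F hy) ht.1 ht.2
    (T.hasDerivAt_F hy ⟨ht.1.le, ht.2.le⟩)

end SoloInformedScaleDatum

end Summit.KontsevichZagierPeriods.KontsevichZagierPeriods.Theorems
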